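import Mathlib
import HarnessLib

/-!
# A finite-type extension of affine domains which is injective on closed points is birational,
# with universal denominators (Zariski's Main Theorem, characteristic 0)

Topic `Literature/RingTheory/IntegralClosure`. THEOREMS ONLY (no definition, no named fact; D-0026).

Let `k` be an algebraically closed field of characteristic `0`, `A ⊆ B` finitely generated `k`-domains
such that over every maximal ideal of `A` there is AT MOST ONE maximal ideal of `B` (the morphism
`Spec B → Spec A` is injective on closed points). Then for every maximal ideal `n₀` of `B` there are
`r ∈ B ∖ n₀` and `0 ≠ a ∈ A` with `a rᴺ b ∈ A` for every `b ∈ B` (`N` depending on `b`)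
(`exists_denominators_of_injective_on_maximalIdeals`): near every point, `B` is `A` up to one
denominator from `A` and one from `B`. This is the algebraic content of «a bijective morphism of
varieties in characteristic `0` is birational» combined with Zariski's Main Theorem; it is the
commutative-algebra core of the tree's proof that the orbit map of a closed `SL`-orbit is a quotient
(`Computability/AlgebraicComplexity/SLOrbitQuotient*`, discharging `Grosshans1997_thm_1_11_slOrbit_forms`).

Route (elementary given Mathlib):
* § 1 residue fields: over an algebraically closed field the residue field of a maximal ideal of a
  finitely generated algebra is `k` (Zariski's lemma, Mathlib `finite_of_finite_type_of_isJacobsonRing`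
  + `IsAlgClosed.algebraMap_bijective_of_isIntegral`); maximal ideals contract to maximal ideals;
  every non-zero element of an affine domain avoids some maximal ideal (Jacobson property).
* § 2 quasi-finiteness: if `n` is the only maximal ideal of `B` over `m = n ∩ A`, the fibre of
  `Spec B → Spec A` over `m` is `{n}` (Jacobson property), so `B` is quasi-finite at `n`
  (Mathlib `Algebra.QuasiFiniteAt.of_isOpen_singleton_fiber`).
* § 3 birationality of finite extensions (the characteristic-`0` step): if `T ⊇ A` is a FINITE
  extension of domains with at most one maximal ideal (avoiding a fixed `0 ≠ r ∈ T`) over each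
  maximal ideal of `A`, then `T ⊆ Frac(A)`: otherwise some `t ∈ T` has minimal polynomial over
  `K = Frac A` of degree `d ≥ 2`; after clearing denominators (`scaleRoots`) it is a monic separable
  `ν ∈ A[X]`, whose reduction at a generic maximal ideal `m` has `d` distinct roots in `k`, each giving
  a maximal ideal of `A[t]` over `m` and (lying over) of `T` — two distinct maximal ideals of `T` over
  `m`, both avoiding `r`.
* § 4 Zariski's Main Theorem (Mathlib `Algebra.ZariskisMainProperty.of_finiteType`, stacks 00Q9):
  quasi-finiteness at `n₀` yields `r ∉ n₀` and a finite sub-`A`-algebra `T ⊆ B` with `rᴺ b ∈ T` for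
  all `b`; § 3 applied to `T` gives the denominators.

Honest framing: standard commutative algebra (EGA IV 8.12.6 / stacks 00Q9 flavour); no new facts.

## References

* [StacksProject] The Stacks Project, Tag 00Q9 (Zariski's Main Theorem, algebraic version), Tag 00GB.
* [Grosshans1997] F. D. Grosshans, *Algebraic Homogeneous Spaces and Invariant Theory*, LNM 1673
  (1997), Thm. 1.11 (the consumer: orbit maps are quotients in characteristic `0`).

## Provenance

Cell `val-lit`, seat `val-lit-t02` generation 7 (programme #7, brick Q3/Q4-core).
-/

noncomputable section

open Polynomial

namespace Literature.RingTheory.IntegralClosure.InjectiveOnPointsBirational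

universe u v w

/-! ### § 1 Residue fields, contraction of maximal ideals, generic maximal ideals -/

section Residue

variable {k : Type u} [Field k] {A : Type v} {B : Type w} [CommRing A] [CommRing B]
  [Algebra k A] [Algebra k B]

/-- Over an algebraically closed field, the residue field of a maximal ideal of a finitely generated
algebra is the ground field (Zariski's lemma). [cite: StacksProject, Tag 00GB] -/
theorem algebraMap_quotient_bijective [IsAlgClosed k] [Algebra.FiniteType k B] (n : Ideal B)
    [n.IsMaximal] : Function.Bijective (algebraMap k (B ⧸ n)) := by
  letI : Field (B ⧸ n) := Ideal.Quotient.field n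
  have : Module.Finite k (B ⧸ n) := finite_of_finite_type_of_isJacobsonRing k (B ⧸ n)
  have : Algebra.IsIntegral k (B ⧸ n) := Algebra.IsIntegral.of_finite k (B ⧸ n)
  exact IsAlgClosed.algebraMap_bijective_of_isIntegral

/-- A maximal ideal of a finitely generated algebra over an algebraically closed field is the kernel
of a `k`-algebra homomorphism onto `k`. [cite: StacksProject, Tag 00GB] -/
theorem exists_algHom_ker_eq [IsAlgClosed k] [Algebra.FiniteType k B] (n : Ideal B) [n.IsMaximal] :
    ∃ χ : B →ₐ[k] k, RingHom.ker χ = n := by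
  set e : k ≃ₐ[k] B ⧸ n := AlgEquiv.ofBijective (Algebra.ofId k (B ⧸ n)) (algebraMap_quotient_bijective n)
  refine ⟨e.symm.toAlgHom.comp (Ideal.Quotient.mkₐ k n), ?_⟩
  ext b
  rw [RingHom.mem_ker, AlgHom.comp_apply, Ideal.Quotient.mkₐ_eq_mk]
  change e.symm (Ideal.Quotient.mk n b) = 0 ↔ b ∈ n
  rw [map_eq_zero_iff _ e.symm.injective, Ideal.Quotient.eq_zero_iff_mem]

/-- Maximal ideals of a finitely generated algebra over an algebraically closed field contract, along
any `k`-algebra homomorphism, to maximal ideals. [cite: StacksProject, Tag 00GB] -/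
theorem isMaximal_comap_algHom [IsAlgClosed k] [Algebra.FiniteType k B] (f : A →ₐ[k] B)
    (n : Ideal B) [n.IsMaximal] : (n.comap f).IsMaximal := by
  obtain ⟨χ, hχ⟩ := exists_algHom_ker_eq (k := k) n
  have h : n.comap f = RingHom.ker (χ.comp f) := by
    rw [← hχ]; rfl
  rw [h]
  refine RingHom.ker_isMaximal_of_surjective _ fun c => ⟨algebraMap k A c, ?_⟩
  simp

/-- In an affine domain every non-zero element avoids some maximal ideal (the Jacobson radical of a
finitely generated domain over a field is zero). [cite: StacksProject, Tag 00GB] -/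
theorem exists_isMaximal_not_mem [IsDomain A] [Algebra.FiniteType k A] {x : A} (hx : x ≠ 0) :
    ∃ m : Ideal A, m.IsMaximal ∧ x ∉ m := by
  have hJ : IsJacobsonRing A := isJacobsonRing_of_finiteType (A := k) (B := A)
  by_contra h
  push Not at h
  have hmem : x ∈ (⊥ : Ideal A).jacobson := by
    rw [Ideal.jacobson, Ideal.mem_sInf]
    rintro J ⟨-, hJ⟩
    exact h J hJ
  rw [← Ideal.radical_eq_jacobson] at hmem
  have hnil : x ∈ nilradical A := hmem
  rw [nilradical_eq_zero, Ideal.zero_eq_bot, Ideal.mem_bot] at hnil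
  exact hx hnil

end Residue

/-! ### § 2 Quasi-finiteness from uniqueness of the maximal ideal over a point -/

section QuasiFinite

variable {A : Type v} {B : Type w} [CommRing A] [CommRing B] [Algebra A B]

/-- If `n` is the only maximal ideal of the Jacobson ring `B` over the maximal ideal `m = n ∩ A`,
then every prime of `B` over `m` equals `n`. [cite: StacksProject, Tag 00Q9] -/
theorem eq_of_comap_eq_of_forall_isMaximal [IsJacobsonRing B] (n : Ideal B) [n.IsMaximal]
    (huniq : ∀ n' : Ideal B, n'.IsMaximal →
      n.comap (algebraMap A B) ≤ n'.comap (algebraMap A B) → n' = n)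
    (P : Ideal B) [hP : P.IsPrime] (hPc : P.comap (algebraMap A B) = n.comap (algebraMap A B)) :
    P = n := by
  have hle : ∀ J : Ideal B, J.IsMaximal → P ≤ J → J = n := fun J hJ hPJ =>
    huniq J hJ (hPc ▸ Ideal.comap_mono hPJ)
  obtain ⟨n', hn', hPn'⟩ := P.exists_le_maximal hP.ne_top
  refine le_antisymm (hle n' hn' hPn' ▸ hPn') ?_
  have hJ : P.jacobson = P := (isJacobsonRing_iff_prime_eq.mp ‹_›) P hP
  rw [← hJ, Ideal.jacobson]
  refine le_sInf ?_
  rintro J ⟨hPJ, hJ⟩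
  rw [hle J hJ hPJ]

/-- **Quasi-finiteness at an isolated point.** If `n` is the only maximal ideal of the finitely
generated `A`-algebra `B` (a Jacobson ring) over `m = n ∩ A`, then `B` is quasi-finite at `n`: the
fibre over `m` is the single point `n`. [cite: StacksProject, Tag 00Q9] -/
theorem quasiFiniteAt_of_forall_isMaximal [IsJacobsonRing B] [Algebra.FiniteType A B] (n : Ideal B)
    [hn : n.IsMaximal]
    (huniq : ∀ n' : Ideal B, n'.IsMaximal →
      n.comap (algebraMap A B) ≤ n'.comap (algebraMap A B) → n' = n) :
    Algebra.QuasiFiniteAt A n := by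
  let q : PrimeSpectrum B := ⟨n, hn.isPrime⟩
  change Algebra.QuasiFiniteAt A q.asIdeal
  refine Algebra.QuasiFiniteAt.of_isOpen_singleton_fiber q ?_
  have huniv : ({⟨q, rfl⟩} : Set ((PrimeSpectrum.comap (algebraMap A B)) ⁻¹'
      {q.comap (algebraMap A B)})) = Set.univ := by
    refine Set.eq_univ_of_forall fun x => ?_
    rw [Set.mem_singleton_iff]
    have hx : (PrimeSpectrum.comap (algebraMap A B)) x.1 = q.comap (algebraMap A B) := x.2
    have hx' : x.1.asIdeal.comap (algebraMap A B) = n.comap (algebraMap A B) :=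
      congrArg PrimeSpectrum.asIdeal hx
    haveI := x.1.2
    have := eq_of_comap_eq_of_forall_isMaximal n huniq x.1.asIdeal hx'
    exact Subtype.ext (PrimeSpectrum.ext this)
  rw [huniv]
  exact isOpen_univ

end QuasiFinite

/-! ### § 3 Finite extensions with at most one point over each point are birational (characteristic 0) -/

section ScaleRoots

variable {K : Type u} [Field K]

/-- Scaling the roots twice. [folklore] -/
private theorem scaleRoots_scaleRoots (p : K[X]) (r s : K) :
    (p.scaleRoots r).scaleRoots s = p.scaleRoots (r * s) := by
  ext i
  simp only [coeff_scaleRoots, natDegree_scaleRoots, mul_pow, mul_assoc]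

/-- Scaling the roots by a unit preserves irreducibility. [folklore] -/
private theorem irreducible_scaleRoots {p : K[X]} (hp : Irreducible p) {r : K} (hr : r ≠ 0) :
    Irreducible (p.scaleRoots r) := by
  have hback : ∀ q : K[X], (q.scaleRoots r).scaleRoots r⁻¹ = q := fun q => by
    rw [scaleRoots_scaleRoots, mul_inv_cancel₀ hr, scaleRoots_one]
  refine ⟨fun hu => hp.1 ?_, fun a b hab => ?_⟩
  · rw [Polynomial.isUnit_iff_degree_eq_zero] at hu ⊢
    rwa [degree_scaleRoots] at hu
  · have h := congrArg (fun q => q.scaleRoots r⁻¹) hab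
    simp only [hback, Polynomial.mul_scaleRoots_of_noZeroDivisors] at h
    rcases hp.2 h with ha | hb
    · left
      rw [Polynomial.isUnit_iff_degree_eq_zero] at ha ⊢
      rwa [degree_scaleRoots] at ha
    · right
      rw [Polynomial.isUnit_iff_degree_eq_zero] at hb ⊢
      rwa [degree_scaleRoots] at hb

end ScaleRoots

section Birational

variable (k : Type u) [Field k] [IsAlgClosed k] [CharZero k]
variable {A : Type v} {T : Type w} [CommRing A] [IsDomain A]
  [CommRing T] [IsDomain T] [Algebra A T] [Module.Finite A T]

omit [IsAlgClosed k] in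
/-- Characteristic `0` passes from `k` to any `k`-domain. [folklore] -/
private theorem charZero_of_algebra (R : Type*) [CommRing R] [IsDomain R] [Algebra k R] : CharZero R :=
  charZero_of_injective_algebraMap (algebraMap k R).injective

/-- **Birationality (the characteristic-`0` step).** Let `A ⊆ T` be a finite extension of domains,
`A` finitely generated over an algebraically closed field `k` of characteristic `0`, and `0 ≠ r ∈ T`
such that two maximal ideals of `T` not containing `r` with the same contraction to `A` coincide.
Then every `t ∈ T` is a fraction `c/a` of elements of `A`. [cite: StacksProject, Tag 00Q9 (with 00GB)] -/
theorem exists_smul_eq_algebraMap [Algebra k A] [Algebra.FiniteType k A]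
    (hinj : Function.Injective (algebraMap A T)) {r : T} (hr : r ≠ 0)
    (huniq : ∀ n₁ n₂ : Ideal T, n₁.IsMaximal → n₂.IsMaximal → r ∉ n₁ → r ∉ n₂ →
      n₁.comap (algebraMap A T) = n₂.comap (algebraMap A T) → n₁ = n₂)
    (t : T) : ∃ a c : A, a ≠ 0 ∧ a • t = algebraMap A T c := by
  classical
  haveI : CharZero A := charZero_of_algebra k A
  -- fraction fields `K = Frac A ⊆ L = Frac T`
  have hinjTL : Function.Injective (algebraMap T (FractionRing T)) :=
    IsFractionRing.injective T (FractionRing T)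
  have hinjAL : Function.Injective (algebraMap A (FractionRing T)) := by
    rw [IsScalarTower.algebraMap_eq A T (FractionRing T)]
    exact hinjTL.comp hinj
  haveI : FaithfulSMul A (FractionRing T) := (faithfulSMul_iff_algebraMap_injective A _).mpr hinjAL
  letI : Algebra (FractionRing A) (FractionRing T) := FractionRing.liftAlgebra A (FractionRing T)
  haveI : IsScalarTower A (FractionRing A) (FractionRing T) :=
    FractionRing.isScalarTower_liftAlgebra A (FractionRing T)
  haveI : CharZero (FractionRing A) :=
    charZero_of_injective_algebraMap (IsFractionRing.injective A (FractionRing A))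
  set K := FractionRing A with hK
  set L := FractionRing T with hL
  have hinjAK : Function.Injective (algebraMap A K) := IsFractionRing.injective A K
  set t' : L := algebraMap T L t with ht'
  have hint : IsIntegral A t := Algebra.IsIntegral.isIntegral t
  have hint' : IsIntegral A t' := hint.map (IsScalarTower.toAlgHom A T L)
  have hintK : IsIntegral K t' := hint'.tower_top
  set μ : K[X] := minpoly K t' with hμ
  by_cases hd : μ.natDegree = 1
  · -- `t' ∈ K`: read off the fraction
    obtain ⟨κ, hκ⟩ := minpoly.natDegree_eq_one_iff.mp hd
    obtain ⟨⟨c, a⟩, hca⟩ := IsLocalization.mk'_surjective (nonZeroDivisors A) κ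
    simp only at hca
    subst hca
    refine ⟨a, c, nonZeroDivisors.ne_zero a.2, hinjTL ?_⟩
    have h1 : algebraMap T L ((a : A) • t) = (a : A) • t' := by
      rw [Algebra.smul_def, map_mul, ← IsScalarTower.algebraMap_apply, Algebra.smul_def]
    have h2 : (a : A) • (IsLocalization.mk' K c a) = algebraMap A K c := by
      rw [Algebra.smul_def, IsLocalization.mul_mk'_eq_mk'_of_mul, IsLocalization.mk'_mul_cancel_left]
    rw [h1, ← hκ, ← IsScalarTower.algebraMap_apply A T L, IsScalarTower.algebraMap_apply A K L,
      ← h2, Algebra.smul_def, Algebra.smul_def, map_mul, ← IsScalarTower.algebraMap_apply]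
  · exfalso
    have hd2 : 2 ≤ μ.natDegree := by
      have h0 : 0 < μ.natDegree := by rw [hμ]; exact minpoly.natDegree_pos hintK
      omega
    -- clear the denominators of `μ`: `ν ∈ A[X]` monic with `ν ↦ μ.scaleRoots β`, `β = b/1`
    obtain ⟨b, hb, hbμ⟩ := IsLocalization.integerNormalization_spec (nonZeroDivisors A) μ
    set β : K := algebraMap A K b with hβ
    have hb0 : (b : A) ≠ 0 := nonZeroDivisors.ne_zero hb
    have hβ0 : β ≠ 0 := fun h => hb0 (hinjAK (by rw [← hβ, h, map_zero]))
    set νK : K[X] := μ.scaleRoots β with hνK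
    have hμmonic : μ.Monic := minpoly.monic hintK
    have hνKmonic : νK.Monic := (monic_scaleRoots_iff β).mpr hμmonic
    have hcoeffA : ∀ i, algebraMap A K ((IsLocalization.integerNormalization (nonZeroDivisors A) μ).coeff i)
        = β * μ.coeff i := by
      intro i
      have := congrArg (fun q : K[X] => q.coeff i) hbμ
      simp only [coeff_map, coeff_smul] at this
      rw [this, Algebra.smul_def]
    have hlifts : νK ∈ Polynomial.lifts (algebraMap A K) := by
      rw [lifts_iff_coeff_lifts]
      intro i
      rw [hνK, coeff_scaleRoots]
      rcases lt_trichotomy i μ.natDegree with hi | hi | hi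
      · obtain ⟨j, hj⟩ : ∃ j, μ.natDegree - i = j + 1 := ⟨μ.natDegree - i - 1, by omega⟩
        refine ⟨(IsLocalization.integerNormalization (nonZeroDivisors A) μ).coeff i * b ^ j, ?_⟩
        rw [map_mul, map_pow, hcoeffA, ← hβ, hj, pow_succ]
        ring
      · refine ⟨1, ?_⟩
        rw [hi, Nat.sub_self, pow_zero, mul_one, map_one]
        exact hμmonic.coeff_natDegree.symm
      · refine ⟨0, ?_⟩
        rw [map_zero, Polynomial.coeff_eq_zero_of_natDegree_lt hi, zero_mul]
    obtain ⟨ν, hνmap, hνdeg, hνmonic⟩ := lifts_and_natDegree_eq_and_monic hlifts hνKmonic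
    -- `s = b t` is a root of `ν`; `νK` is the minimal polynomial of `s' = β t'`
    set s : T := b • t with hs
    have hs' : algebraMap T L s = algebraMap K L β * t' := by
      rw [hs, Algebra.smul_def, map_mul, ← IsScalarTower.algebraMap_apply, hβ,
        ← IsScalarTower.algebraMap_apply A K L]
    have hνK_irr : Irreducible νK := irreducible_scaleRoots (minpoly.irreducible hintK) hβ0
    have hνK_root : aeval (algebraMap K L β * t') νK = 0 :=
      scaleRoots_aeval_eq_zero (r := β) (minpoly.aeval K t')
    have hνK_min : νK = minpoly K (algebraMap K L β * t') :=
      minpoly.eq_of_irreducible_of_monic hνK_irr hνK_root hνKmonic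
    have hνK_sep : νK.Separable := hνK_irr.separable
    -- every `P ∈ A[X]` with `P(s) = 0` is divisible by `ν`
    have hdiv : ∀ P : A[X], aeval s P = 0 → ν ∣ P := by
      intro P hP
      have h1 : aeval (algebraMap K L β * t') (P.map (algebraMap A K)) = 0 := by
        rw [aeval_map_algebraMap, ← hs', aeval_algebraMap_apply, hP, map_zero]
      have h2 : νK ∣ P.map (algebraMap A K) := by
        rw [hνK_min]; exact minpoly.dvd K _ h1
      rwa [← hνmap, Polynomial.map_dvd_map _ hinjAK hνmonic] at h2
    -- separability data with coefficients in `A`: `U ν + V ν' = C e`, `e ≠ 0`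
    obtain ⟨u, v, huv⟩ := hνK_sep
    obtain ⟨e₁, he₁, hu⟩ := IsLocalization.integerNormalization_spec (nonZeroDivisors A) u
    obtain ⟨e₂, he₂, hv⟩ := IsLocalization.integerNormalization_spec (nonZeroDivisors A) v
    set U : A[X] := IsLocalization.integerNormalization (nonZeroDivisors A) u with hU
    set V : A[X] := IsLocalization.integerNormalization (nonZeroDivisors A) v with hV
    have he₁0 : (e₁ : A) ≠ 0 := nonZeroDivisors.ne_zero he₁
    have he₂0 : (e₂ : A) ≠ 0 := nonZeroDivisors.ne_zero he₂
    rw [Algebra.smul_def, Polynomial.algebraMap_apply] at hu hv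
    have hUV : C e₂ * U * ν + C e₁ * V * derivative ν = C (e₁ * e₂) := by
      apply Polynomial.map_injective (algebraMap A K) hinjAK
      simp only [Polynomial.map_mul, Polynomial.map_add, Polynomial.map_C, ← Polynomial.derivative_map,
        hνmap, hu, hv, map_mul]
      linear_combination (C (algebraMap A K e₁) * C (algebraMap A K e₂)) * huv
    -- `c ∈ rT ∩ A`, non-zero
    have hrint : IsIntegral A r := Algebra.IsIntegral.isIntegral r
    have hcomap : (Ideal.span {r}).comap (algebraMap A T) ≠ ⊥ :=
      Ideal.comap_ne_bot_of_integral_mem hr (Ideal.mem_span_singleton_self r) hrint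
    obtain ⟨c, hcmem, hc0⟩ := Submodule.exists_mem_ne_zero_of_ne_bot hcomap
    rw [Ideal.mem_comap] at hcmem
    -- a maximal ideal `m` of `A` avoiding `e₁ e₂ c`, with its character `χ : A → k`
    obtain ⟨m, hm, hnot⟩ := exists_isMaximal_not_mem (k := k)
      (mul_ne_zero (mul_ne_zero he₁0 he₂0) hc0)
    haveI := hm
    obtain ⟨χ, hχ⟩ := exists_algHom_ker_eq (k := k) m
    have hχe : χ (e₁ * e₂) ≠ 0 := fun h => by
      have he : e₁ * e₂ ∈ m := by rw [← hχ, RingHom.mem_ker]; exact h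
      exact hnot (Ideal.mul_mem_right _ _ he)
    have hcm : c ∉ m := fun hc => hnot (Ideal.mul_mem_left _ _ hc)
    -- the reduction `ν̄` is separable of degree `d ≥ 2`, hence has two distinct roots in `k`
    set νbar : k[X] := ν.map (χ : A →+* k) with hνbar
    have hνbar_sep : νbar.Separable := by
      have h := congrArg (Polynomial.map (χ : A →+* k)) hUV
      simp only [Polynomial.map_mul, Polynomial.map_add, Polynomial.map_C, ← Polynomial.derivative_map,
        AlgHom.coe_toRingHom] at h
      have hCe : C ((χ (e₁ * e₂))⁻¹) * C (χ (e₁ * e₂)) = (1 : k[X]) := by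
        rw [← C_mul, inv_mul_cancel₀ hχe, C_1]
      refine ⟨C (χ (e₁ * e₂))⁻¹ * (C (χ e₂) * U.map (χ : A →+* k)),
        C (χ (e₁ * e₂))⁻¹ * (C (χ e₁) * V.map (χ : A →+* k)), ?_⟩
      rw [hνbar]
      linear_combination (C ((χ (e₁ * e₂))⁻¹)) * h + hCe
    have hνbar_deg : νbar.natDegree = μ.natDegree := by
      rw [hνbar, hνmonic.natDegree_map, hνdeg, natDegree_scaleRoots]
    have hcard : Fintype.card (νbar.rootSet k) = μ.natDegree := by
      rw [← hνbar_deg]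
      exact card_rootSet_eq_natDegree hνbar_sep (IsAlgClosed.splits _)
    obtain ⟨⟨l₁, hl₁⟩, ⟨l₂, hl₂⟩, hne⟩ := Fintype.exists_pair_of_one_lt_card
      (show 1 < Fintype.card (νbar.rootSet k) by omega)
    have hne' : l₁ ≠ l₂ := fun h => hne (Subtype.ext h)
    have hroot : ∀ l ∈ νbar.rootSet k, eval₂ (χ : A →+* k) l ν = 0 := by
      intro l hl
      rw [mem_rootSet] at hl
      have h := hl.2
      rw [hνbar, aeval_def, eval₂_map, Algebra.algebraMap_self, RingHom.id_comp] at h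
      exact h
    -- the characters `θ_l : A[s] → k`, `P(s) ↦ P̄(l)`, on the subring `A[s] = range (aeval s)`
    set f : A[X] →+* T := (aeval s : A[X] →ₐ[A] T).toRingHom with hf
    set Rs : Subring T := f.range with hRs
    have hfsurj : Function.Surjective f.rangeRestrict := f.rangeRestrict_surjective
    have hker : ∀ l ∈ νbar.rootSet k,
        RingHom.ker f.rangeRestrict ≤ RingHom.ker (eval₂RingHom (χ : A →+* k) l) := by
      intro l hl P hP
      rw [RingHom.mem_ker] at hP ⊢
      have hP' : aeval s P = 0 := by
        have := congrArg Subtype.val hP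
        simpa [hf] using this
      obtain ⟨Q, rfl⟩ := hdiv P hP'
      change eval₂ (χ : A →+* k) l (ν * Q) = 0
      rw [eval₂_mul, hroot l hl, zero_mul]
    let θ : ∀ l ∈ νbar.rootSet k, Rs →+* k := fun l hl =>
      f.rangeRestrict.liftOfSurjective hfsurj ⟨eval₂RingHom (χ : A →+* k) l, hker l hl⟩
    have hθf : ∀ l (hl : l ∈ νbar.rootSet k) (P : A[X]), θ l hl (f.rangeRestrict P) = eval₂ (χ : A →+* k) l P :=
      fun l hl P => f.rangeRestrict.liftOfSurjective_comp_apply hfsurj _ P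
    -- `T` is integral over `Rs`
    letI : Algebra Rs T := Rs.subtype.toAlgebra
    have halg : ∀ x : Rs, algebraMap Rs T x = (x : T) := fun x => rfl
    set φ : A →+* Rs := f.rangeRestrict.comp (C : A →+* A[X]) with hφ
    have hφval : ∀ a : A, ((φ a : Rs) : T) = algebraMap A T a := by
      intro a
      change ((f.rangeRestrict (C a) : Rs) : T) = _
      rw [RingHom.coe_rangeRestrict, hf]
      simp
    haveI : Algebra.IsIntegral Rs T := by
      refine ⟨fun x => ?_⟩
      obtain ⟨p, hpmonic, hp⟩ := (Algebra.IsIntegral.isIntegral (R := A) x)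
      refine ⟨p.map φ, hpmonic.map φ, ?_⟩
      rw [eval₂_map]
      have : (algebraMap Rs T).comp φ = algebraMap A T := by
        ext a; rw [RingHom.comp_apply, halg, hφval]
      rw [this]
      exact hp
    -- maximal ideals of `Rs`: the kernels of `θ_l`; lying over them, maximal ideals `𝔑_l` of `T`
    have hθsurj : ∀ l (hl : l ∈ νbar.rootSet k), Function.Surjective (θ l hl) := by
      intro l hl x
      refine ⟨f.rangeRestrict (C (algebraMap k A x)), ?_⟩
      rw [hθf l hl, eval₂_C, AlgHom.coe_toRingHom, AlgHom.commutes, Algebra.algebraMap_self_apply]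
    have hθmax : ∀ l (hl : l ∈ νbar.rootSet k), (RingHom.ker (θ l hl)).IsMaximal :=
      fun l hl => RingHom.ker_isMaximal_of_surjective _ (hθsurj l hl)
    have hkerRsT : RingHom.ker (algebraMap Rs T) ≤ ⊥ := by
      intro x hx
      rw [RingHom.mem_ker, halg] at hx
      exact (Submodule.mem_bot _).mpr (Subtype.ext hx)
    have hN : ∀ l (hl : l ∈ νbar.rootSet k), ∃ N : Ideal T, N.IsMaximal ∧
        N.comap (algebraMap Rs T) = RingHom.ker (θ l hl) := by
      intro l hl
      haveI := hθmax l hl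
      exact Ideal.exists_ideal_over_maximal_of_isIntegral (RingHom.ker (θ l hl))
        (hkerRsT.trans bot_le)
    obtain ⟨N₁, hN₁max, hN₁⟩ := hN l₁ hl₁
    obtain ⟨N₂, hN₂max, hN₂⟩ := hN l₂ hl₂
    -- contraction to `A` is `m`
    have hcomapA : ∀ (l) (hl : l ∈ νbar.rootSet k) (N : Ideal T),
        N.comap (algebraMap Rs T) = RingHom.ker (θ l hl) → N.comap (algebraMap A T) = m := by
      intro l hl N hNc
      ext a
      have h1 : algebraMap A T a = algebraMap Rs T (φ a) := by rw [halg, hφval]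
      rw [Ideal.mem_comap, h1, ← Ideal.mem_comap, hNc, RingHom.mem_ker, hφ, RingHom.comp_apply,
        hθf l hl, eval₂_C, ← hχ, RingHom.mem_ker]
      rfl
    -- both avoid `r`
    have hrN : ∀ (l) (hl : l ∈ νbar.rootSet k) (N : Ideal T), N.IsMaximal →
        N.comap (algebraMap Rs T) = RingHom.ker (θ l hl) → r ∉ N := by
      intro l hl N hNmax hNc hrN
      have hc : algebraMap A T c ∈ N := by
        have := Ideal.span_singleton_le_iff_mem (I := N) |>.mpr hrN
        exact this hcmem
      have : c ∈ N.comap (algebraMap A T) := Ideal.mem_comap.mpr hc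
      rw [hcomapA l hl N hNc] at this
      exact hcm this
    -- distinct: the element `s - l₁` separates them
    have hdistinct : N₁ ≠ N₂ := by
      intro heq
      set x₀ : Rs := f.rangeRestrict (X - C (algebraMap k A l₁)) with hx₀
      have h1 : x₀ ∈ RingHom.ker (θ l₁ hl₁) := by
        rw [RingHom.mem_ker, hx₀, hθf l₁ hl₁, eval₂_sub, eval₂_X, eval₂_C, AlgHom.coe_toRingHom,
          AlgHom.commutes, Algebra.algebraMap_self_apply, sub_self]
      have h2 : x₀ ∉ RingHom.ker (θ l₂ hl₂) := by
        rw [RingHom.mem_ker, hx₀, hθf l₂ hl₂, eval₂_sub, eval₂_X, eval₂_C, AlgHom.coe_toRingHom,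
          AlgHom.commutes, Algebra.algebraMap_self_apply, sub_eq_zero]
        exact fun h => hne' h.symm
      rw [← hN₁, heq, hN₂] at h1
      exact h2 h1
    exact hdistinct (huniq N₁ N₂ hN₁max hN₂max (hrN l₁ hl₁ N₁ hN₁max hN₁) (hrN l₂ hl₂ N₂ hN₂max hN₂)
      ((hcomapA l₁ hl₁ N₁ hN₁).trans (hcomapA l₂ hl₂ N₂ hN₂).symm))

/-- The same with a COMMON denominator: `a T ⊆ A` for some `0 ≠ a ∈ A` (finiteness of `T`).
[cite: StacksProject, Tag 00Q9 (with 00GB)] -/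
theorem exists_forall_smul_mem_range [Algebra k A] [Algebra.FiniteType k A]
    (hinj : Function.Injective (algebraMap A T)) {r : T} (hr : r ≠ 0)
    (huniq : ∀ n₁ n₂ : Ideal T, n₁.IsMaximal → n₂.IsMaximal → r ∉ n₁ → r ∉ n₂ →
      n₁.comap (algebraMap A T) = n₂.comap (algebraMap A T) → n₁ = n₂) :
    ∃ a : A, a ≠ 0 ∧ ∀ t : T, ∃ c : A, a • t = algebraMap A T c := by
  classical
  obtain ⟨S, hS⟩ := Module.finite_def.mp (inferInstance : Module.Finite A T)
  choose fa fc hf using fun t : T => exists_smul_eq_algebraMap k hinj hr huniq t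
  refine ⟨∏ t ∈ S, fa t, Finset.prod_ne_zero_iff.mpr fun t _ => (hf t).1, fun t => ?_⟩
  have ht : t ∈ Submodule.span A (S : Set T) := by rw [hS]; exact Submodule.mem_top
  refine Submodule.span_induction ?_ ?_ ?_ ?_ ht
  · intro x hx
    obtain ⟨P, hP⟩ : ∃ P, ∏ t ∈ S, fa t = P * fa x :=
      ⟨∏ t ∈ S.erase x, fa t, by rw [mul_comm, Finset.mul_prod_erase _ _ hx]⟩
    refine ⟨P * fc x, ?_⟩
    rw [hP, mul_smul, (hf x).2, map_mul, Algebra.smul_def]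
  · exact ⟨0, by simp⟩
  · rintro x y - - ⟨cx, hx⟩ ⟨cy, hy⟩
    exact ⟨cx + cy, by rw [smul_add, hx, hy, map_add]⟩
  · rintro a x - ⟨cx, hx⟩
    exact ⟨a * cx, by rw [smul_comm, hx, map_mul, Algebra.smul_def]⟩

end Birational

/-! ### § 4 Zariski's Main Theorem: denominators near every point -/

section Main

variable (k : Type u) [Field k] [IsAlgClosed k] [CharZero k]
variable {A : Type v} {B : Type w} [CommRing A] [IsDomain A] [CommRing B] [IsDomain B] [Algebra A B]

/-- **Denominators near a point, uniform form** (Zariski's Main Theorem + birationality,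
characteristic `0`). Let `A ⊆ B` be finitely generated domains over an algebraically closed field of
characteristic `0` such that two maximal ideals of `B` with the same contraction to `A` coincide. Then
for every maximal ideal `n₀` of `B` there are `r ∈ B ∖ n₀` and `0 ≠ a ∈ A` such that `a rʲ ∈ A` for
EVERY `j` and, for every `b ∈ B`, `a rⁿ b ∈ A` for all `n ≥ N(b)` (proof: `r` and the `r^{m_x} x`,
`x` a generator, span a finite subalgebra `T ∋ r` with `a T ⊆ A`). This is the shape consumed by the
conductor/homogeneity endgame of the orbit-quotient theorem (`a·r ∈ A` is the case `j = 1`).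
[cite: StacksProject, Tag 00Q9] -/
theorem exists_denominators_of_injective_on_maximalIdeals' [Algebra k A] [Algebra.FiniteType k A]
    [Algebra k B] [Algebra.FiniteType k B] [IsScalarTower k A B]
    (hinj : Function.Injective (algebraMap A B))
    (huniq : ∀ n₁ n₂ : Ideal B, n₁.IsMaximal → n₂.IsMaximal →
      n₁.comap (algebraMap A B) = n₂.comap (algebraMap A B) → n₁ = n₂)
    (n₀ : Ideal B) [hn₀ : n₀.IsMaximal] :
    ∃ r : B, r ∉ n₀ ∧ ∃ a : A, a ≠ 0 ∧
      (∀ j : ℕ, ∃ c : A, a • r ^ j = algebraMap A B c) ∧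
      ∀ b : B, ∃ N : ℕ, ∀ n : ℕ, N ≤ n → ∃ c : A, a • (r ^ n * b) = algebraMap A B c := by
  classical
  haveI : Algebra.FiniteType A B := Algebra.FiniteType.of_restrictScalars_finiteType k A B
  haveI : IsJacobsonRing B := isJacobsonRing_of_finiteType (A := k) (B := B)
  -- quasi-finite at `n₀`
  have hm : (n₀.comap (algebraMap A B)).IsMaximal :=
    isMaximal_comap_algHom (k := k) (IsScalarTower.toAlgHom k A B) n₀
  haveI : Algebra.QuasiFiniteAt A n₀ :=
    quasiFiniteAt_of_forall_isMaximal n₀ fun n' hn' hle =>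
      huniq n' n₀ hn' hn₀ (hm.eq_of_le (Ideal.comap_ne_top _ hn'.ne_top) hle).symm
  -- Zariski's Main Theorem at `n₀`
  obtain ⟨r, hrn, hpow⟩ := Algebra.zariskisMainProperty_iff'.mp
    (Algebra.ZariskisMainProperty.of_finiteType (R := A) n₀)
  have hr0 : r ≠ 0 := fun h => hrn (h ▸ n₀.zero_mem)
  choose mexp hmexp using hpow
  -- the finite subalgebra `T = A[r, r^{m_x} x : x a generator]`
  obtain ⟨gens, hgens⟩ := Algebra.FiniteType.out (R := A) (A := B)
  set S : Set B := insert r ((fun x => r ^ mexp x * x) '' (gens : Set B)) with hSdef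
  have hSfin : S.Finite := ((gens.finite_toSet).image _).insert r
  have hSint : ∀ x ∈ S, IsIntegral A x := by
    rintro x (rfl | ⟨y, -, rfl⟩)
    · have h := hmexp x
      rw [← pow_succ] at h
      exact (IsIntegral.pow_iff (Nat.succ_pos _)).mp h
    · exact hmexp y
  set T : Subalgebra A B := Algebra.adjoin A S with hTdef
  haveI : Module.Finite A T := Algebra.finite_adjoin_of_finite_of_isIntegral hSfin hSint
  have hrT : r ∈ T := Algebra.subset_adjoin (Set.mem_insert r _)
  have hsat : ∀ b : B, ∃ N : ℕ, r ^ N * b ∈ T := by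
    intro b
    have hb : b ∈ Algebra.adjoin A (gens : Set B) := by rw [hgens]; trivial
    refine Algebra.adjoin_induction (p := fun b _ => ∃ N : ℕ, r ^ N * b ∈ T) ?_ ?_ ?_ ?_ hb
    · intro x hx
      exact ⟨mexp x, Algebra.subset_adjoin (Set.mem_insert_of_mem r ⟨x, hx, rfl⟩)⟩
    · intro a
      exact ⟨0, by rw [pow_zero, one_mul]; exact Subalgebra.algebraMap_mem T a⟩
    · rintro x y - - ⟨Nx, hx⟩ ⟨Ny, hy⟩
      refine ⟨Nx + Ny, ?_⟩
      have : r ^ (Nx + Ny) * (x + y) = r ^ Ny * (r ^ Nx * x) + r ^ Nx * (r ^ Ny * y) := by ring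
      rw [this]
      exact add_mem (T.mul_mem (T.pow_mem hrT Ny) hx) (T.mul_mem (T.pow_mem hrT Nx) hy)
    · rintro x y - - ⟨Nx, hx⟩ ⟨Ny, hy⟩
      refine ⟨Nx + Ny, ?_⟩
      have : r ^ (Nx + Ny) * (x * y) = (r ^ Nx * x) * (r ^ Ny * y) := by ring
      rw [this]
      exact T.mul_mem hx hy
  -- `T` as a ring: a domain, finite over `A`, with `A → T` injective
  have hinjT : Function.Injective (algebraMap A T) := fun a₁ a₂ h => hinj (by
    have := congrArg (fun x : T => (x : B)) h
    simpa using this)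
  set rT : T := ⟨r, hrT⟩ with hrTdef
  have hrT0 : rT ≠ 0 := fun h => hr0 (by
    have := congrArg (fun x : T => (x : B)) h
    simpa [hrTdef] using this)
  -- maximal ideals of `T` avoiding `r` extend to maximal ideals of `B` avoiding `r`
  have hext : ∀ 𝔫 : Ideal T, 𝔫.IsMaximal → rT ∉ 𝔫 →
      ∃ M : Ideal B, M.IsMaximal ∧ M.comap (T.val : T →+* B) = 𝔫 := by
    intro 𝔫 h𝔫 hr𝔫
    -- the saturation `P = {b | r^N b ∈ 𝔫}` is a proper ideal of `B` containing `𝔫`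
    let P : Ideal B :=
      { carrier := {b | ∃ (N : ℕ) (h : r ^ N * b ∈ T), (⟨r ^ N * b, h⟩ : T) ∈ 𝔫}
        zero_mem' := ⟨0, by rw [pow_zero, one_mul]; exact T.zero_mem, by
          have : (⟨r ^ 0 * 0, by rw [pow_zero, one_mul]; exact T.zero_mem⟩ : T) = 0 :=
            Subtype.ext (by simp)
          rw [this]; exact 𝔫.zero_mem⟩
        add_mem' := by
          rintro b₁ b₂ ⟨N₁, h₁, h₁'⟩ ⟨N₂, h₂, h₂'⟩
          have hm₁ : r ^ N₂ * (r ^ N₁ * b₁) ∈ T := T.mul_mem (T.pow_mem hrT N₂) h₁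
          have hm₂ : r ^ N₁ * (r ^ N₂ * b₂) ∈ T := T.mul_mem (T.pow_mem hrT N₁) h₂
          have hsum : r ^ (N₁ + N₂) * (b₁ + b₂) ∈ T := by
            have : r ^ (N₁ + N₂) * (b₁ + b₂) = r ^ N₂ * (r ^ N₁ * b₁) + r ^ N₁ * (r ^ N₂ * b₂) := by
              ring
            rw [this]; exact add_mem hm₁ hm₂
          refine ⟨N₁ + N₂, hsum, ?_⟩
          have : (⟨r ^ (N₁ + N₂) * (b₁ + b₂), hsum⟩ : T) =
              ⟨r ^ N₂, T.pow_mem hrT N₂⟩ * ⟨r ^ N₁ * b₁, h₁⟩ +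
                ⟨r ^ N₁, T.pow_mem hrT N₁⟩ * ⟨r ^ N₂ * b₂, h₂⟩ :=
            Subtype.ext (by simp only [Subalgebra.coe_add, Subalgebra.coe_mul]; ring)
          rw [this]
          exact add_mem (𝔫.mul_mem_left _ h₁') (𝔫.mul_mem_left _ h₂')
        smul_mem' := by
          rintro c b ⟨N, h, h'⟩
          obtain ⟨M, hM⟩ := hsat c
          have hprod : r ^ (M + N) * (c • b) ∈ T := by
            have : r ^ (M + N) * (c • b) = (r ^ M * c) * (r ^ N * b) := by
              rw [smul_eq_mul]; ring
            rw [this]; exact T.mul_mem hM h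
          refine ⟨M + N, hprod, ?_⟩
          have : (⟨r ^ (M + N) * (c • b), hprod⟩ : T) = ⟨r ^ M * c, hM⟩ * ⟨r ^ N * b, h⟩ :=
            Subtype.ext (by simp only [Subalgebra.coe_mul, smul_eq_mul]; ring)
          rw [this]
          exact 𝔫.mul_mem_left _ h' }
    have hP𝔫 : ∀ t : T, t ∈ 𝔫 → (t : B) ∈ P := fun t ht =>
      ⟨0, by rw [pow_zero, one_mul]; exact t.2, by
        have : (⟨r ^ 0 * (t : B), by rw [pow_zero, one_mul]; exact t.2⟩ : T) = t :=
          Subtype.ext (by simp)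
        rw [this]; exact ht⟩
    have hPtop : P ≠ ⊤ := by
      intro htop
      have h1 : (1 : B) ∈ P := htop ▸ Submodule.mem_top
      obtain ⟨N, h, h'⟩ := h1
      have : (⟨r ^ N * 1, h⟩ : T) = rT ^ N := Subtype.ext (by simp [hrTdef])
      rw [this] at h'
      exact hr𝔫 (h𝔫.isPrime.mem_of_pow_mem N h')
    obtain ⟨M, hMmax, hPM⟩ := Ideal.exists_le_maximal P hPtop
    refine ⟨M, hMmax, ?_⟩
    have hle : 𝔫 ≤ M.comap (T.val : T →+* B) := fun t ht => Ideal.mem_comap.mpr (hPM (hP𝔫 t ht))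
    exact (h𝔫.eq_of_le (Ideal.comap_ne_top _ hMmax.ne_top) hle).symm
  have huniqT : ∀ n₁ n₂ : Ideal T, n₁.IsMaximal → n₂.IsMaximal → rT ∉ n₁ → rT ∉ n₂ →
      n₁.comap (algebraMap A T) = n₂.comap (algebraMap A T) → n₁ = n₂ := by
    intro n₁ n₂ hn₁ hn₂ hr₁ hr₂ hcomap
    obtain ⟨M₁, hM₁, hM₁c⟩ := hext n₁ hn₁ hr₁
    obtain ⟨M₂, hM₂, hM₂c⟩ := hext n₂ hn₂ hr₂
    have hAT : ∀ M : Ideal B, (M.comap (T.val : T →+* B)).comap (algebraMap A T) =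
        M.comap (algebraMap A B) := by
      intro M; ext a; simp only [Ideal.mem_comap]; rfl
    have hM : M₁ = M₂ := huniq M₁ M₂ hM₁ hM₂ (by rw [← hAT, ← hAT, hM₁c, hM₂c, hcomap])
    rw [← hM₁c, ← hM₂c, hM]
  -- birationality of the finite piece `T`, then clear the denominators `r^n`, `n ≥ N`
  obtain ⟨a, ha0, ha⟩ := exists_forall_smul_mem_range k hinjT hrT0 huniqT
  have hcoe : ∀ t : T, ∃ c : A, a • (t : B) = algebraMap A B c := fun t => by
    obtain ⟨c, hc⟩ := ha t
    refine ⟨c, ?_⟩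
    have := congrArg (fun x : T => (x : B)) hc
    simpa [Algebra.smul_def] using this
  refine ⟨r, hrn, a, ha0, fun j => hcoe ⟨r ^ j, T.pow_mem hrT j⟩, fun b => ?_⟩
  obtain ⟨N, hN⟩ := hsat b
  refine ⟨N, fun n hn => ?_⟩
  have hmem : r ^ n * b ∈ T := by
    have : r ^ n * b = r ^ (n - N) * (r ^ N * b) := by
      rw [← mul_assoc, ← pow_add, Nat.sub_add_cancel hn]
    rw [this]
    exact T.mul_mem (T.pow_mem hrT _) hN
  exact hcoe ⟨r ^ n * b, hmem⟩

/-- **Denominators near a point** (Zariski's Main Theorem + birationality, characteristic `0`). Let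
`A ⊆ B` be finitely generated domains over an algebraically closed field of characteristic `0` such
that two maximal ideals of `B` with the same contraction to `A` coincide. Then for every maximal
ideal `n₀` of `B` there are `r ∈ B ∖ n₀` and `0 ≠ a ∈ A` such that `a rᴺ b ∈ A` for every `b ∈ B`
(`N` depending on `b`). [cite: StacksProject, Tag 00Q9] -/
theorem exists_denominators_of_injective_on_maximalIdeals [Algebra k A] [Algebra.FiniteType k A]
    [Algebra k B] [Algebra.FiniteType k B] [IsScalarTower k A B]
    (hinj : Function.Injective (algebraMap A B))
    (huniq : ∀ n₁ n₂ : Ideal B, n₁.IsMaximal → n₂.IsMaximal →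
      n₁.comap (algebraMap A B) = n₂.comap (algebraMap A B) → n₁ = n₂)
    (n₀ : Ideal B) [hn₀ : n₀.IsMaximal] :
    ∃ r : B, r ∉ n₀ ∧ ∃ a : A, a ≠ 0 ∧
      ∀ b : B, ∃ (N : ℕ) (c : A), a • (r ^ N * b) = algebraMap A B c := by
  obtain ⟨r, hrn, a, ha0, -, hb⟩ := exists_denominators_of_injective_on_maximalIdeals' k hinj huniq n₀
  refine ⟨r, hrn, a, ha0, fun b => ?_⟩
  obtain ⟨N, hN⟩ := hb b
  obtain ⟨c, hc⟩ := hN N le_rfl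
  exact ⟨N, c, hc⟩

end Main

end Literature.RingTheory.IntegralClosure.InjectiveOnPointsBirational

end
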